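import Summits.QuantumFields.YangMills.Theorems.UnitScaleTiltProp7LinearCorrectorBound
import Summits.QuantumFields.YangMills.Theorems.UnitScaleTiltProp7LinearCorrectorT3
import Summits.QuantumFields.YangMills.Theorems.UnitScaleTiltProp7PinnedCovSupRowT3
import HarnessLib

/-!
# Route `UnitScaleTilt`, crux K1 «MinimiserStabilityRegPr» (stmt-QuantumFields-19200), route-R E′ path (α′), (E1-b) AT THE MEMBER — the linear corrector `L = LinCorr_W` of
# ✓ `Prop7LinearCorrectorT3.exists_linCorr_T3` (px13 g3) EXISTS at every `SU(2)` background `W` of run `K`, level `K − n`, and its door row `hL : p (L A) ≤ C_L·q A`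
# (✓ `Prop7LinearCorrectorBound.linCorr_gauge_le_of_rows`) holds with `C_L = max (3c_I∕2) (max c_I c₂)` as soon as the two covariant rows (hK) (hK₂) hold for THIS `L`

Cell `ym3-torus`, D-0154 (3c) twin-width seat `ym-routeR-w3` (gen 6) = namer of the (hK)∕(A)∕(E1-b) lineage.  The member reading the (E1-e) knit (★p1) instantiates: background rows `hU` by
✓ `Prop7ExactCorrectorGaugeSockets.unitsField_toUField_norm_le_one`, level range by ✓ `Prop7PinnedCovSupRowT3.level_le`, `d = 3`, `(F.P K).L = F.L`.  THEOREMS ONLY (0 `def`, 0 `sorry`);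
`--supports stmt-QuantumFields-19200`, count-neutral.  YM₃ on T³ is a ladder rung (R3), not the Clay problem; nothing here claims the stub, the crux, d = 4 or the gap.

WHAT IS PROVED (ns `…Theorems.Prop7LinearCorrectorMember`; `𝒰 := fun κ z => unitsField (toUField W) ⟨z, κ⟩`, `ℓ := L^{K−n}`).
* ★★ `linCorr_gauge_le_of_rows_member` — for ANY map `L` pinned at the `(K − n)`-centres: (hK) ∧ (hK₂) ⇒ `∀ A, p (L A) ≤ max (3c_I∕2) (max c_I c₂)·q A` (the door at the member's letters).
* ★★★ `exists_linCorr_member` — `∃ I L`, px13's four characterisations (interpolant, `L A = φ − Iφ` for every potential, pinning, solvability) AND the door implication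
  `∀ c_I c₂ ≥ 0, (hK for L) → (hK₂ for L) → ∀ A, p (L A) ≤ max (3c_I∕2) (max c_I c₂)·q A`, for every gauge `p` of the knit's shape and every size `q` dominating `ℓ²‖D*_𝒰A‖_∞`.
HONEST SCOPE.  Composition of ✓p671932 and ✓p671456; (hK)-cov and (hK₂)-cov stay DISPLAYED (P-cov2 routeR-w6 g6; (hK₂-cov) px11 g3's chain).  Constants ours.

References: T. Bałaban, CMP 102 (1985) 277–309 [Balaban1985Variational] (Prop. 7 p.299); CMP 99 (1985) 75–102 [Balaban1985RegularSpaces] ((1.14) p.78, (1.36) p.82);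
CMP 99 (1985) 389–434 [Balaban1985BackgroundPropagators] ((3.3) p.390, (3.8) p.392).
-/

set_option autoImplicit false

noncomputable section

open scoped BigOperators Matrix.Norms.L2Operator Matrix

namespace Summit.QuantumFields.YangMills.Theorems.Prop7LinearCorrectorMember

open Literature.MathematicalPhysics.QuantumFieldTheory.Balaban1983to89
open B9Eq39Adjoint (covD divB)
open B9TorusCalculus (torusT)
open B15DeterminingSets (embIter)
open B10Eq27TorusAxialLog (unitsField toUField)
open T3ContinuumYM3Torus (T3Family)
open Summit.QuantumFields.YangMills.Theorems.Prop7ExactCorrectorGaugeSockets (unitsField_toUField_norm_le_one)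
open Summit.QuantumFields.YangMills.Theorems.Prop7PinnedCovSupRowT3 (level_le)
open Summit.QuantumFields.YangMills.Theorems.Prop7LinearCorrectorBound (linCorr_gauge_le_of_rows)
open Summit.QuantumFields.YangMills.Theorems.Prop7LinearCorrectorT3 (exists_linCorr_T3)

/-- ★★ **THE (E1-b) DOOR AT THE MEMBER'S LETTERS**: run `K` of a T³ family, level `K − n`, `SU(2)` background `W`, `ℓ = L^{K−n}`; ANY map `L` from bond fields to site fields pinned at the
`(K − n)`-centres; gauge `p ψ = max ‖ψ‖ (max (ℓ·‖D_Wψ‖) (ℓ·‖T₂ψ‖))`, size `q` with `ℓ²·‖D*_WA‖_∞ ≤ q A`.  Then (hK) `‖D_W(L A)(x,μ)‖ ≤ c_I·ℓ·‖D*_WA‖_∞` and (hK₂) `‖T₂(L A)‖ ≤ c₂·ℓ·‖D*_WA‖_∞`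
give `p (L A) ≤ max (3c_I∕2) (max c_I c₂)·q A`. [cite: Balaban1985Variational, Prop. 7 p.299; Balaban1985RegularSpaces, (1.36) p.82] -/
theorem linCorr_gauge_le_of_rows_member (F : T3Family) (K n : ℕ) (W : GaugeField (F.P K) 0 (Matrix.specialUnitaryGroup (Fin 2) ℂ))
    {E₂ : Type*} [SeminormedAddCommGroup E₂] (T₂ : (Site (F.P K) 0 → Matrix (Fin 2) (Fin 2) ℂ) → E₂)
    (p : (Site (F.P K) 0 → Matrix (Fin 2) (Fin 2) ℂ) → ℝ)
    (hp : ∀ ψ, p ψ = max ‖ψ‖ (max ((F.L : ℝ) ^ (K - n) * ‖(fun μ z => covD (torusT (F.P K) 0) (fun κ z => unitsField (toUField W) ⟨z, κ⟩) μ ψ z)‖)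
      ((F.L : ℝ) ^ (K - n) * ‖T₂ ψ‖)))
    (q : (Fin (F.P K).d → Site (F.P K) 0 → Matrix (Fin 2) (Fin 2) ℂ) → ℝ)
    (hq : ∀ A, ((F.L : ℝ) ^ (K - n)) ^ 2 * ‖(fun x => divB (torusT (F.P K) 0) (fun κ z => unitsField (toUField W) ⟨z, κ⟩) A x)‖ ≤ q A)
    (L : (Fin (F.P K).d → Site (F.P K) 0 → Matrix (Fin 2) (Fin 2) ℂ) → (Site (F.P K) 0 → Matrix (Fin 2) (Fin 2) ℂ))
    (hLC : ∀ (A) (y : Site (F.P K) (K - n)), L A (embIter (K - n) y) = 0)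
    {cI c₂ : ℝ} (hcI : 0 ≤ cI) (hc₂ : 0 ≤ c₂)
    (hK : ∀ (A) (μ : Fin (F.P K).d) (x : Site (F.P K) 0),
      ‖covD (torusT (F.P K) 0) (fun κ z => unitsField (toUField W) ⟨z, κ⟩) μ (L A) x‖
        ≤ cI * (F.L : ℝ) ^ (K - n) * ‖(fun x => divB (torusT (F.P K) 0) (fun κ z => unitsField (toUField W) ⟨z, κ⟩) A x)‖)
    (hK₂ : ∀ A, ‖T₂ (L A)‖ ≤ c₂ * (F.L : ℝ) ^ (K - n) * ‖(fun x => divB (torusT (F.P K) 0) (fun κ z => unitsField (toUField W) ⟨z, κ⟩) A x)‖)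
    (A : Fin (F.P K).d → Site (F.P K) 0 → Matrix (Fin 2) (Fin 2) ℂ) :
    p (L A) ≤ max (3 / 2 * cI) (max cI c₂) * q A := by
  have hd : ((F.P K).d : ℝ) = 3 := by
    have : (F.P K).d = 3 := rfl
    rw [this]; norm_num
  have hL : ((F.P K).L : ℝ) = (F.L : ℝ) := by
    have : (F.P K).L = F.L := rfl
    rw [this]
  have h := linCorr_gauge_le_of_rows (P := F.P K) (level_le F K n) (fun κ z => unitsField (toUField W) ⟨z, κ⟩)
    (fun μ z => unitsField_toUField_norm_le_one W ⟨z, μ⟩) T₂ p (by intro ψ; rw [hp ψ, hL]) q (by intro B; rw [hL]; exact hq B) L hLC hcI hc₂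
    (by intro B μ x; rw [hL]; exact hK B μ x) (by intro B; rw [hL]; exact hK₂ B) A
  rw [hd] at h
  have e : (3 : ℝ) / 2 * cI = 3 / 2 * cI := rfl
  simpa only [e] using h

/-- ★★★ **(E1-b) AT THE MEMBER, PACKAGED**: at every `SU(2)` background `W` of run `K` and every level `K − n` there are the interpolation map `I` and the linear corrector `L` of ✓ `exists_linCorr_T3`
(pinned `Δ_W`-biharmonic interpolant; `L A = φ − Iφ` for EVERY potential `Δ_Wφ = D*_WA`; `L A` vanishes at the centres; potentials exist), and for every gauge `p` of the knit's shape and every size `q`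
dominating `ℓ²‖D*_WA‖_∞` the door implication holds: `∀ c_I c₂ ≥ 0, (hK for L) → (hK₂ for L) → ∀ A, p (L A) ≤ max (3c_I∕2) (max c_I c₂)·q A`.
[cite: Balaban1985Variational, Prop. 7 p.299; Balaban1985RegularSpaces, (1.14) p.78, (1.36) p.82; Balaban1985BackgroundPropagators, (3.8) p.392] -/
theorem exists_linCorr_member (F : T3Family) (K n : ℕ) (W : GaugeField (F.P K) 0 (Matrix.specialUnitaryGroup (Fin 2) ℂ))
    {E₂ : Type*} [SeminormedAddCommGroup E₂] (T₂ : (Site (F.P K) 0 → Matrix (Fin 2) (Fin 2) ℂ) → E₂)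
    (p : (Site (F.P K) 0 → Matrix (Fin 2) (Fin 2) ℂ) → ℝ)
    (hp : ∀ ψ, p ψ = max ‖ψ‖ (max ((F.L : ℝ) ^ (K - n) * ‖(fun μ z => covD (torusT (F.P K) 0) (fun κ z => unitsField (toUField W) ⟨z, κ⟩) μ ψ z)‖)
      ((F.L : ℝ) ^ (K - n) * ‖T₂ ψ‖)))
    (q : (Fin (F.P K).d → Site (F.P K) 0 → Matrix (Fin 2) (Fin 2) ℂ) → ℝ)
    (hq : ∀ A, ((F.L : ℝ) ^ (K - n)) ^ 2 * ‖(fun x => divB (torusT (F.P K) 0) (fun κ z => unitsField (toUField W) ⟨z, κ⟩) A x)‖ ≤ q A) :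
    ∃ (I : (Site (F.P K) 0 → Matrix (Fin 2) (Fin 2) ℂ) →+ (Site (F.P K) 0 → Matrix (Fin 2) (Fin 2) ℂ))
      (L : (Fin (F.P K).d → Site (F.P K) 0 → Matrix (Fin 2) (Fin 2) ℂ) →+ (Site (F.P K) 0 → Matrix (Fin 2) (Fin 2) ℂ)),
      -- (I) the pinned `Δ_W`-biharmonic interpolant, characterised
      (∀ φ, ((∀ y : Site (F.P K) (K - n), I φ (embIter (K - n) y) = φ (embIter (K - n) y)) ∧
          ∀ x : Site (F.P K) 0, x ∉ Set.range (embIter (K - n)) →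
            divB (torusT (F.P K) 0) (fun κ z => unitsField (toUField W) ⟨z, κ⟩)
              (fun μ => covD (torusT (F.P K) 0) (fun κ z => unitsField (toUField W) ⟨z, κ⟩) μ
                (fun y => divB (torusT (F.P K) 0) (fun κ z => unitsField (toUField W) ⟨z, κ⟩)
                  (fun ν => covD (torusT (F.P K) 0) (fun κ z => unitsField (toUField W) ⟨z, κ⟩) ν (I φ)) y)) x = 0) ∧
        ∀ χ, (∀ y : Site (F.P K) (K - n), χ (embIter (K - n) y) = φ (embIter (K - n) y)) →
          (∀ x : Site (F.P K) 0, x ∉ Set.range (embIter (K - n)) →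
            divB (torusT (F.P K) 0) (fun κ z => unitsField (toUField W) ⟨z, κ⟩)
              (fun μ => covD (torusT (F.P K) 0) (fun κ z => unitsField (toUField W) ⟨z, κ⟩) μ
                (fun y => divB (torusT (F.P K) 0) (fun κ z => unitsField (toUField W) ⟨z, κ⟩)
                  (fun ν => covD (torusT (F.P K) 0) (fun κ z => unitsField (toUField W) ⟨z, κ⟩) ν χ) y)) x = 0) → χ = I φ) ∧
      -- (L) the corrector for every potential
      (∀ A φ, (∀ x, divB (torusT (F.P K) 0) (fun κ z => unitsField (toUField W) ⟨z, κ⟩)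
            (fun μ => covD (torusT (F.P K) 0) (fun κ z => unitsField (toUField W) ⟨z, κ⟩) μ φ) x
          = divB (torusT (F.P K) 0) (fun κ z => unitsField (toUField W) ⟨z, κ⟩) A x) → L A = φ - I φ) ∧
      -- pinning
      (∀ (A) (y : Site (F.P K) (K - n)), L A (embIter (K - n) y) = 0) ∧
      -- solvability
      (∀ A, ∃ φ, (∀ x, divB (torusT (F.P K) 0) (fun κ z => unitsField (toUField W) ⟨z, κ⟩)
            (fun μ => covD (torusT (F.P K) 0) (fun κ z => unitsField (toUField W) ⟨z, κ⟩) μ φ) x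
          = divB (torusT (F.P K) 0) (fun κ z => unitsField (toUField W) ⟨z, κ⟩) A x) ∧ L A = φ - I φ) ∧
      -- ★ the door: (hK) ∧ (hK₂) ⇒ hL
      (∀ cI c₂ : ℝ, 0 ≤ cI → 0 ≤ c₂ →
        (∀ (A) (μ : Fin (F.P K).d) (x : Site (F.P K) 0),
          ‖covD (torusT (F.P K) 0) (fun κ z => unitsField (toUField W) ⟨z, κ⟩) μ (L A) x‖
            ≤ cI * (F.L : ℝ) ^ (K - n) * ‖(fun x => divB (torusT (F.P K) 0) (fun κ z => unitsField (toUField W) ⟨z, κ⟩) A x)‖) →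
        (∀ A, ‖T₂ (L A)‖ ≤ c₂ * (F.L : ℝ) ^ (K - n) * ‖(fun x => divB (torusT (F.P K) 0) (fun κ z => unitsField (toUField W) ⟨z, κ⟩) A x)‖) →
        ∀ A, p (L A) ≤ max (3 / 2 * cI) (max cI c₂) * q A) := by
  obtain ⟨I, L, hI, hLφ, hLC, hsolv⟩ := exists_linCorr_T3 F K (K - n) W
  exact ⟨I, L, hI, hLφ, hLC, hsolv, fun cI c₂ hcI hc₂ hK hK₂ A =>
    linCorr_gauge_le_of_rows_member F K n W T₂ p hp q hq L hLC hcI hc₂ hK hK₂ A⟩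

end Summit.QuantumFields.YangMills.Theorems.Prop7LinearCorrectorMember

end
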